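import Mathlib
import Summits.MatrixMultiplication.Statement
import Summits.MatrixMultiplication.MatrixMultiplication.Theorems.GraphEquationsForwardAD
import Summits.MatrixMultiplication.MatrixMultiplication.Theorems.GraphEquationsQuadraticInitialForms
import Summits.MatrixMultiplication.MatrixMultiplication.Theorems.GraphEquationsCoeffIdentity
import Summits.MatrixMultiplication.MatrixMultiplication.Theorems.GraphEquationsDegreeLadder
import Summits.MatrixMultiplication.MatrixMultiplication.Theorems.GraphEquationsCubicDictionaryConverse

/-!
# Rigid quadric systems are purified by ONE constant vertical step (`GraphEquations`, kernel M72)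

Decomp-mm node «GraphEquations» (lens 5); attacked leaf `MultiplicityReduction`
(stmt-MatrixMultiplication-27806); target of the node, VERBATIM: `_root_.MatrixMultiplication`.

Kernel M71 (`GraphEquationsDegreeFourMasking`) shows that from test degree `4` on the isolation ORDER
of the test ideal is no currency: CHAIN SYSTEMS (`f_{p_i} − f_{p_{i+1}}²`, `f_{p₀}²`) are masked to
order `2^{n²} − 1` over EVERY base pair.  This file shows that those witnesses — and the whole class
they belong to — are nevertheless harmless for `[ω₄ = ω]`: they are purified by ONE DEFLATION STEP
along a CONSTANT fibre direction, at cost `4·cost + n²`.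

## The class: RIGID QUADRIC systems (`EqSystem.IsRigidQuad`)

Every test is `l ⬝ f + ⟨f, a f⟩` — a polynomial of degree `≤ 2` in the generators `f_q = c_q − (ab)_q`
with CONSTANT coefficients (no constant term; degree `≤ 4` in `a, b, c`, `IsRigidQuad.isDegLe_four`).
Equivalently: in the fibre coordinates `F = C − AB` the test ideal has constant coefficients
(`rigidF`).  Chains, squared systems `{f_q²}`, `{f_p f_q, …}` are rigid quadric; pivot designs are not.

## The mechanism (`IsRigidQuad.exists_reduced_deflation`)

Correctness says the affine quadrics `P_o = ℓ_o + Q_o` on `ℂ^{n²}` have `0` as their only common zero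
(`IsRigidQuad.fibre_isolated`: test at the points `(0, 0, F)`).  On `K = ⋂ ker ℓ_o` the quadratic
parts then have no common nonzero zero, so by the ISOTROPIC KERNEL LEMMA (`isotropicKernelLemma_all`,
M66, contrapositive) there is `γ ∈ K` whose polars `B_o(γ, ·)` have trivial common kernel on `K`
(`exists_rigid_direction`; `γ = 0` if `K = 0`).  Deflating along the CONSTANT field `μ = γ`
(`constSystem`, forward-mode AD `forwardModeAD`, M15d) appends `D_γ t_o = ℓ_o(γ) + B_o(γ, f) = B_o(γ,f)`:
the field is a kernel field (`ℓ_o(γ) = 0`), so the deflated system is CORRECT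
(`Correct.of_deflatesTo`), and its linear parts `{ℓ_o} ∪ {B_o(γ,·)}` isolate `0` — the deflated test
family is initially isolated to order `1` over EVERY base pair, hence REDUCED at every graph point
(`reducedAt_of_idealInitIsolatedAt_one`, M13b).  One vertical step, direction independent of the
base: the exact dual of the horizontal one-round unmasking of pivot designs (M57–M66), whose masked
direction MOVES with the base and whose coefficients are not constant.

## Results (no `sorry`)

* `exists_rigid_direction` — the linear algebra (ISO, contrapositive form);
* `IsRigidQuad.exists_reduced_deflation : E.Correct → E.IsRigidQuad →
    ∃ E', E'.Correct ∧ (∀ y, E'.ReducedAt (graphPoint y)) ∧ E'.cost ≤ 4·E.cost + n²`;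
* `EqAdmissibleRigidQuad β` and `eqAdmissibleRed_of_rigidQuad`, `omega_le_of_eqAdmissibleRigidQuad :
  2 ≤ β → EqAdmissibleRigidQuad β → omega ℂ ≤ β` — the RIGID-QUADRIC SUB-RUNG of
  `EquationsForceMultiplicationDeg 4` (`eqAdmissibleDeg_four_of_rigidQuad` places it on the ladder).

Sources: Leykin–Verschelde–Zhao, *Newton's method with deflation for isolated singularities*,
TCS 359 (2006) [doi:10.1016/j.tcs.2006.02.018], Thm. 3.1 (one deflation step per unit of depth;
here depth is exponential in `n²` yet ONE step suffices, because the step is chosen by ISO, not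
generically); [BurgisserClausenShokrollahi1997, §7.1 (derivatives of straight-line programs),
Problem 16.3].
-/

set_option linter.dupNamespace false

noncomputable section

open scoped BigOperators

namespace Summit.MatrixMultiplication.MatrixMultiplication.Theorems.GraphEquations

open MvPolynomial Matrix
open Literature.Computability.AlgebraicComplexity

variable {n : ℕ}

/-! ## Linear and quadratic forms in the generators -/

/-- The linear form `F ↦ l ⬝ F` as a polynomial. -/
def linFormPoly (l : Fin n × Fin n → ℂ) : MvPolynomial (Fin n × Fin n) ℂ := ∑ q, C (l q) * X q

/-- `linFormPoly l` evaluates to `l ⬝ F`. -/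
theorem eval_linFormPoly (l F : Fin n × Fin n → ℂ) : eval F (linFormPoly l) = l ⬝ᵥ F := by
  simp [linFormPoly, dotProduct, map_sum]

/-- `linFormPoly l` is a linear form. -/
theorem isHomogeneous_linFormPoly (l : Fin n × Fin n → ℂ) : (linFormPoly l).IsHomogeneous 1 :=
  IsHomogeneous.sum _ _ _ fun q _ => by
    simpa using (isHomogeneous_C _ (l q)).mul (isHomogeneous_X ℂ q)

/-- `matQuadPoly a` is a quadratic form. -/
theorem isHomogeneous_matQuadPoly (a : Matrix (Fin n × Fin n) (Fin n × Fin n) ℂ) :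
    (matQuadPoly a).IsHomogeneous 2 :=
  IsHomogeneous.sum _ _ _ fun q _ => IsHomogeneous.sum _ _ _ fun q' _ => by
    simpa using ((isHomogeneous_C _ (a q q')).mul (isHomogeneous_X ℂ q)).mul (isHomogeneous_X ℂ q')

/-- The polar of a linear form is the constant `l ⬝ γ`. -/
theorem polarDeriv_linFormPoly (γ l : Fin n × Fin n → ℂ) :
    polarDeriv γ (linFormPoly l) = C (l ⬝ᵥ γ) := by
  classical
  simp only [polarDeriv, linFormPoly, map_sum, pderiv_C_mul, pderiv_X, Pi.single_apply, mul_ite,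
    mul_one, mul_zero, Finset.sum_ite_eq', Finset.mem_univ, if_true, dotProduct, ← C_mul]
  exact Finset.sum_congr rfl fun q _ => by ring

/-- The polar of `⟨F, aF⟩` along `γ` evaluates to `γ ⬝ (a + aᵀ) F`. -/
theorem eval_polarDeriv_matQuadPoly (a : Matrix (Fin n × Fin n) (Fin n × Fin n) ℂ)
    (γ F : Fin n × Fin n → ℂ) :
    eval F (polarDeriv γ (matQuadPoly a)) = γ ⬝ᵥ ((a + aᵀ) *ᵥ F) := by
  classical
  simp only [polarDeriv, map_sum, map_mul, eval_C, eval_pderiv_matQuadPoly, dotProduct]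

/-- `Ψ (map C P) = P(f)`: substituting the generators into a constant-coefficient polynomial. -/
theorem substF_map_C (P : MvPolynomial (Fin n × Fin n) ℂ) :
    substF n (map (C : ℂ →+* MvPolynomial (MatMulVars n) ℂ) P) = aeval (generator n) P := by
  rw [substF, eval₂Hom_map_hom]
  have h : (liftAB n).comp (C : ℂ →+* MvPolynomial (MatMulVars n) ℂ) =
      (C : ℂ →+* MvPolynomial (GraphVars n) ℂ) := RingHom.ext fun c => liftAB_C c
  rw [h, aeval_def, algebraMap_eq, coe_eval₂Hom]

/-- Evaluating `P(f)` at a point: `P` at the values of the generators. -/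
theorem eval_aeval_generator (x : GraphVars n → ℂ) (P : MvPolynomial (Fin n × Fin n) ℂ) :
    eval x (aeval (generator n) P) = eval (fun q => eval x (generator n q)) P := by
  rw [aeval_eq_bind₁]
  exact eval₂Hom_bind₁ _ _ _ _

/-- `map (eval y) ∘ map C = id` on `ℂ[F]`. -/
theorem map_eval_map_C (y : MatMulVars n → ℂ) (P : MvPolynomial (Fin n × Fin n) ℂ) :
    map (eval y) (map (C : ℂ →+* MvPolynomial (MatMulVars n) ℂ) P) = P := by
  rw [MvPolynomial.map_map]
  have h : (eval y).comp (C : ℂ →+* MvPolynomial (MatMulVars n) ℂ) = RingHom.id ℂ :=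
    RingHom.ext fun c => eval_C c
  rw [h, MvPolynomial.map_id]

/-- The point `(a, b, c) = (0, 0, F)`; there `f_q = F_q`. -/
def fibrePoint (F : Fin n × Fin n → ℂ) : GraphVars n → ℂ
  | Sum.inl _ => 0
  | Sum.inr q => F q

/-- `f_q(0, 0, F) = F_q`. -/
theorem eval_fibrePoint_generator (F : Fin n × Fin n → ℂ) (q : Fin n × Fin n) :
    eval (fibrePoint F) (generator n q) = F q := by
  simp [generator, fibrePoint, map_sum]

/-! ## Rigid quadric systems -/

namespace EqSystem

/-- **RIGID QUADRIC system**: every test is `l ⬝ f + ⟨f, a f⟩`, a polynomial of degree `≤ 2` in the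
generators with CONSTANT coefficients and no constant term. -/
def IsRigidQuad (E : EqSystem n) : Prop :=
  ∀ j ∈ E.tests, ∃ (l : Fin n × Fin n → ℂ) (a : Matrix (Fin n × Fin n) (Fin n × Fin n) ℂ),
    E.testPoly j = aeval (generator n) (linFormPoly l + matQuadPoly a)

/-- Rigid quadric tests have degree `≤ 4`. -/
theorem IsRigidQuad.isDegLe_four {E : EqSystem n} (h : E.IsRigidQuad) : E.IsDegLe 4 := by
  intro o
  obtain ⟨l, a, hla⟩ := h _ (List.get_mem _ o)
  rw [hla, map_add]
  have hg := totalDegree_generator_le_two n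
  refine (totalDegree_add _ _).trans (max_le ?_ ?_)
  · rw [linFormPoly, map_sum]
    refine totalDegree_finsetSum_le fun q _ => ?_
    rw [map_mul, aeval_C, aeval_X, algebraMap_eq]
    calc _ ≤ (C (l q) : MvPolynomial (GraphVars n) ℂ).totalDegree + (generator n q).totalDegree :=
        totalDegree_mul _ _
      _ ≤ 4 := by rw [totalDegree_C]; have := hg q; omega
  · rw [matQuadPoly, map_sum]
    refine totalDegree_finsetSum_le fun q _ => ?_
    rw [map_sum]
    refine totalDegree_finsetSum_le fun q' _ => ?_
    rw [map_mul, map_mul, aeval_C, aeval_X, aeval_X, algebraMap_eq]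
    calc _ ≤ (C (a q q') * generator n q).totalDegree + (generator n q').totalDegree :=
        totalDegree_mul _ _
      _ ≤ ((C (a q q') : MvPolynomial (GraphVars n) ℂ).totalDegree + (generator n q).totalDegree) +
          (generator n q').totalDegree := by gcongr; exact totalDegree_mul _ _
      _ ≤ 4 := by rw [totalDegree_C]; have := hg q; have := hg q'; omega

/-- **Fibre isolation**: for a correct rigid quadric system with data `(l_o, a_o)`, the affine quadrics
`F ↦ l_o ⬝ F + ⟨F, a_o F⟩` have `0` as their only common zero (test the points `(0, 0, F)`). -/
theorem fibre_isolated {E : EqSystem n} (hE : E.Correct)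
    (l : Fin E.tests.length → Fin n × Fin n → ℂ)
    (a : Fin E.tests.length → Matrix (Fin n × Fin n) (Fin n × Fin n) ℂ)
    (hla : ∀ o, E.testPoly (E.tests.get o) = aeval (generator n) (linFormPoly (l o) + matQuadPoly (a o)))
    (F : Fin n × Fin n → ℂ) (hF : ∀ o, l o ⬝ᵥ F + F ⬝ᵥ (a o *ᵥ F) = 0) : F = 0 := by
  have hx : fibrePoint F ∈ E.zeroSet := by
    intro j hj
    obtain ⟨o, ho⟩ := List.get_of_mem hj
    rw [← ho, hla o, eval_aeval_generator]
    simp only [eval_fibrePoint_generator, map_add, eval_linFormPoly, eval_matQuadPoly]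
    exact hF o
  rw [hE.2] at hx
  funext q
  obtain ⟨i, k⟩ := q
  have h := hx i k
  simpa [fibrePoint] using h

end EqSystem

/-! ## The direction: ISO, contrapositive form -/

/-- **The rigid direction.**  If the affine quadrics `l_o ⬝ F + ⟨F, a_o F⟩` have only the common zero
`0`, there is `γ` in the common kernel `K` of the `l_o` such that the polars `F ↦ γ ⬝ (a_o + a_oᵀ) F`
have trivial common kernel on `K`.  (ISO on `K`: otherwise every `γ ∈ K` has a nonzero
polar-orthogonal `δ ∈ K`, so some `x ∈ K ∖ 0` is isotropic for every `a_o`, i.e. a common zero.) -/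
theorem exists_rigid_direction {T : ℕ} (l : Fin T → Fin n × Fin n → ℂ)
    (a : Fin T → Matrix (Fin n × Fin n) (Fin n × Fin n) ℂ)
    (hfib : ∀ F : Fin n × Fin n → ℂ, (∀ o, l o ⬝ᵥ F + F ⬝ᵥ (a o *ᵥ F) = 0) → F = 0) :
    ∃ γ : Fin n × Fin n → ℂ, (∀ o, l o ⬝ᵥ γ = 0) ∧
      ∀ δ : Fin n × Fin n → ℂ, (∀ o, l o ⬝ᵥ δ = 0) →
        (∀ o, γ ⬝ᵥ ((a o + (a o)ᵀ) *ᵥ δ) = 0) → δ = 0 := by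
  classical
  let K : Submodule ℂ (Fin n × Fin n → ℂ) :=
    { carrier := {F | ∀ o, l o ⬝ᵥ F = 0}
      add_mem' := fun {x y} hx hy o => by
        simp only [Set.mem_setOf_eq] at hx hy ⊢; rw [dotProduct_add, hx o, hy o, add_zero]
      zero_mem' := fun o => by simp
      smul_mem' := fun c x hx o => by
        simp only [Set.mem_setOf_eq] at hx ⊢; rw [dotProduct_smul, hx o, smul_zero] }
  have hmemK : ∀ {F}, F ∈ K ↔ ∀ o, l o ⬝ᵥ F = 0 := fun {F} => Iff.rfl
  let b : Fin T → K →ₗ[ℂ] K →ₗ[ℂ] ℂ := fun o =>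
    LinearMap.mk₂ ℂ (fun x y => (x : Fin n × Fin n → ℂ) ⬝ᵥ ((a o + (a o)ᵀ) *ᵥ (y : Fin n × Fin n → ℂ)))
      (fun x x' y => by simp only [Submodule.coe_add, add_dotProduct])
      (fun c x y => by simp only [Submodule.coe_smul, smul_dotProduct])
      (fun x y y' => by simp only [Submodule.coe_add, mulVec_add, dotProduct_add])
      (fun c x y => by simp only [Submodule.coe_smul, mulVec_smul, dotProduct_smul])
  have hb : ∀ o (x y : K), b o x y =
      (x : Fin n × Fin n → ℂ) ⬝ᵥ ((a o + (a o)ᵀ) *ᵥ (y : Fin n × Fin n → ℂ)) := fun _ _ _ => rfl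
  by_cases hK : ∃ x : K, x ≠ 0
  · by_contra H
    push Not at H
    have hyp : ∀ x : K, x ≠ 0 → ∃ y : K, y ≠ 0 ∧ ∀ o, b o x y = 0 := fun x _ => by
      obtain ⟨δ, hδK, hδ, hδ0⟩ := H x (hmemK.1 x.2)
      exact ⟨⟨δ, hmemK.2 hδK⟩, fun h => hδ0 (congrArg Subtype.val h), fun o => by rw [hb]; exact hδ o⟩
    obtain ⟨x, hx0, hx⟩ := isotropicKernelLemma_all _ K le_rfl T b hK hyp
    refine hx0 (Subtype.ext (hfib _ fun o => ?_))
    have h1 : l o ⬝ᵥ (x : Fin n × Fin n → ℂ) = 0 := hmemK.1 x.2 o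
    have h2 := hx o
    rw [hb, add_mulVec, dotProduct_add, mulVec_transpose, dotProduct_comm _ (vecMul _ _),
      ← dotProduct_mulVec, add_self_eq_zero] at h2
    rw [h1, h2, add_zero]
  · push Not at hK
    refine ⟨0, fun o => by simp, fun δ hδ _ => ?_⟩
    exact congrArg Subtype.val (hK ⟨δ, hmemK.2 hδ⟩)

/-! ## One constant vertical step purifies a rigid quadric system -/

/-- The rigid lift `G(l,a) = l ⬝ F + ⟨F, aF⟩ ∈ ℂ[A,B][F]` (constant coefficients). -/
def rigidF (l : Fin n × Fin n → ℂ) (a : Matrix (Fin n × Fin n) (Fin n × Fin n) ℂ) : FPoly n :=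
  map (C : ℂ →+* MvPolynomial (MatMulVars n) ℂ) (linFormPoly l + matQuadPoly a)

/-- `Ψ(G(l,a)) = l ⬝ f + ⟨f, a f⟩`. -/
theorem substF_rigidF (l : Fin n × Fin n → ℂ) (a : Matrix (Fin n × Fin n) (Fin n × Fin n) ℂ) :
    substF n (rigidF l a) = aeval (generator n) (linFormPoly l + matQuadPoly a) :=
  substF_map_C _

/-- The homogeneous components of `G(l,a)`: `0`, the linear form, the quadratic form. -/
theorem homogeneousComponent_rigidF (l : Fin n × Fin n → ℂ)
    (a : Matrix (Fin n × Fin n) (Fin n × Fin n) ℂ) (j : ℕ) :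
    homogeneousComponent j (rigidF l a) =
      (if j = 1 then map (C : ℂ →+* MvPolynomial (MatMulVars n) ℂ) (linFormPoly l) else 0) +
      (if j = 2 then map (C : ℂ →+* MvPolynomial (MatMulVars n) ℂ) (matQuadPoly a) else 0) := by
  rw [rigidF, map_add, map_add,
    homogeneousComponent_of_mem ((mem_homogeneousSubmodule _ _).2 ((isHomogeneous_linFormPoly l).map _)),
    homogeneousComponent_of_mem ((mem_homogeneousSubmodule _ _).2 ((isHomogeneous_matQuadPoly a).map _))]

/-- `D_γ G(l,a)` has constant term `l ⬝ γ`; it vanishes for `γ` in the kernel of `l`. -/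
theorem constantCoeff_polarDeriv_rigidF (l γ : Fin n × Fin n → ℂ)
    (a : Matrix (Fin n × Fin n) (Fin n × Fin n) ℂ) (hγ : l ⬝ᵥ γ = 0) :
    homogeneousComponent 0 (polarDeriv (fun q => C (γ q)) (rigidF l a)) = 0 := by
  rw [homogeneousComponent_polarDeriv, zero_add, homogeneousComponent_rigidF, if_pos rfl,
    if_neg (by norm_num), add_zero, ← map_polarDeriv, polarDeriv_linFormPoly, hγ, C_0, map_zero]

/-- **ONE CONSTANT VERTICAL STEP PURIFIES A RIGID QUADRIC SYSTEM.**  A correct rigid quadric system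
has a CORRECT deflation along a constant fibre field, of cost `≤ 4·cost + n²`, that is REDUCED at
the graph point over EVERY base pair. -/
theorem EqSystem.IsRigidQuad.exists_reduced_deflation {E : EqSystem n} (hR : E.IsRigidQuad)
    (hE : E.Correct) :
    ∃ E' : EqSystem n, E'.Correct ∧ (∀ y, E'.ReducedAt (graphPoint y)) ∧
      E'.cost ≤ 4 * E.cost + n * n := by
  classical
  choose l a hla using fun o : Fin E.tests.length => hR (E.tests.get o) (List.get_mem _ o)
  obtain ⟨γ, hγK, hγ⟩ := exists_rigid_direction l a (EqSystem.fibre_isolated hE l a hla)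
  -- the constant field `μ = γ`, computed by `constSystem γ` at cost `n²`
  have hμE : ∀ q, ∃ j ∈ (constSystem γ).tests, (constSystem γ).testPoly j = liftAB n (C (γ q)) :=
    fun q => ⟨_, by simp only [constSystem, List.mem_range]; exact (Fintype.equivFin _ q).isLt,
      constSystem_testPoly γ q⟩
  obtain ⟨E', hfan, hD, hshape, hcost⟩ :=
    forwardModeAD n E (constSystem γ) (fun q => C (γ q)) hE.1 (constSystem_isFanInTwo γ) hμE
  -- `γ` is a kernel field: `D_γ t_o = B_o(γ, f)` has no constant term since `l_o ⬝ γ = 0`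
  have hKF : ∀ j ∈ E.tests, derivC (fun q => C (γ q)) (E.testPoly j) ∈ graphIdeal n := fun j hj => by
    obtain ⟨o, ho⟩ := List.get_of_mem hj
    have h0 := constantCoeff_polarDeriv_rigidF (l o) γ (a o) (hγK o)
    rw [homogeneousComponent_zero, C_eq_zero] at h0
    rw [← ho, hla o, ← substF_rigidF, ← substF_polarDeriv, substF_mem_graphIdeal_iff, constantCoeff_eq]
    exact h0
  have hE' : E'.Correct := hE.of_deflatesTo hfan hD hshape hKF
  refine ⟨E', hE', fun y => EqSystem.reducedAt_of_idealInitIsolatedAt_one hE' ?_, ?_⟩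
  swap
  · rw [constSystem_cost] at hcost; exact hcost
  -- the deflated family is initially isolated to order `1` over every `y`
  have hmem : ∀ t, (∃ j' ∈ E'.tests, E'.testPoly j' = t) →
      t ∈ Ideal.span (Set.range fun o' : Fin E'.tests.length => E'.testPoly (E'.tests.get o')) := by
    rintro t ⟨j', hj', rfl⟩
    obtain ⟨o', ho'⟩ := List.get_of_mem hj'
    exact Ideal.subset_span ⟨o', congrArg E'.testPoly ho'⟩
  refine ⟨E.tests.length + E.tests.length,
    Fin.append (fun o => E.testPoly (E.tests.get o))
      (fun o => derivC (fun q => C (γ q)) (E.testPoly (E.tests.get o))),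
    fun i => ?_, fun _ => 1,
    Fin.append (fun o => rigidF (l o) (a o)) (fun o => polarDeriv (fun q => C (γ q)) (rigidF (l o) (a o))),
    fun _ => le_rfl, fun i => ?_, fun i j hj => ?_, fun F₀ hF => hγ F₀ (fun o => ?_) (fun o => ?_)⟩
  · induction i using Fin.addCases with
    | left o => simp only [Fin.append_left]; exact hmem _ (hD.1 _ (List.get_mem _ o))
    | right o => simp only [Fin.append_right]; exact hmem _ (hD.2 _ (List.get_mem _ o))
  · induction i using Fin.addCases with
    | left o => simp only [Fin.append_left, substF_rigidF, hla]
    | right o => simp only [Fin.append_right, substF_polarDeriv, substF_rigidF, hla]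
  · have hj0 : j = 0 := by simp only at hj; omega
    subst hj0
    induction i using Fin.addCases with
    | left o =>
      simp only [Fin.append_left]
      rw [homogeneousComponent_rigidF, if_neg (by norm_num), if_neg (by norm_num), add_zero]
    | right o => simp only [Fin.append_right]; exact constantCoeff_polarDeriv_rigidF _ _ _ (hγK o)
  · have h := hF (Fin.castAdd _ o)
    simp only [Fin.append_left] at h
    rw [homogeneousComponent_rigidF, if_pos rfl, if_neg (by norm_num), add_zero,
      map_eval_map_C, eval_linFormPoly, eval_linFormPoly, dotProduct_zero] at h
    exact h
  · have h := hF (Fin.natAdd _ o)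
    simp only [Fin.append_right] at h
    rw [homogeneousComponent_polarDeriv, homogeneousComponent_rigidF,
      if_neg (by norm_num), if_pos rfl, zero_add, ← map_polarDeriv, map_eval_map_C,
      eval_polarDeriv_matQuadPoly, eval_polarDeriv_matQuadPoly, mulVec_zero, dotProduct_zero] at h
    exact h

/-! ## The rigid-quadric sub-rung of `[ω₄ = ω]` -/

/-- `EqAdmissibleRigidQuad β`: correct RIGID QUADRIC systems of cost `O(n^β)` exist for all `n ≥ 1`. -/
def EqAdmissibleRigidQuad (β : ℝ) : Prop :=
  ∃ c : ℝ, ∀ n : ℕ, 1 ≤ n → ∃ E : EqSystem n, E.Correct ∧ E.IsRigidQuad ∧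
    (E.cost : ℝ) ≤ c * (n : ℝ) ^ β

/-- Rigid quadric admissibility sits on rung `4` of the degree ladder (M67). -/
theorem eqAdmissibleDeg_four_of_rigidQuad {β : ℝ} (h : EqAdmissibleRigidQuad β) :
    EqAdmissibleDeg 4 β := by
  obtain ⟨c, hc⟩ := h
  refine ⟨c, fun n hn => ?_⟩
  obtain ⟨E, hE, hR, hcost⟩ := hc n hn
  exact ⟨E, hE, hR.isDegLe_four, hcost⟩

/-- **Rigid quadric ⇒ generically reduced, same exponent** (one constant vertical step). -/
theorem eqAdmissibleRed_of_rigidQuad {β : ℝ} (hβ : 2 ≤ β) (h : EqAdmissibleRigidQuad β) :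
    EqAdmissibleRed β := by
  obtain ⟨c, hc⟩ := h
  refine ⟨4 * c + 1, fun n hn => ?_⟩
  obtain ⟨E, hE, hR, hcost⟩ := hc n hn
  obtain ⟨E', hE', hred, hcost'⟩ := hR.exists_reduced_deflation hE
  refine ⟨E', hE', ⟨graphPoint 0, graphPoint_mem_mmGraph _, hred 0⟩, ?_⟩
  have h1 : (1 : ℝ) ≤ n := by exact_mod_cast hn
  have hn2 : (n : ℝ) * n ≤ (n : ℝ) ^ β := by
    calc (n : ℝ) * n = (n : ℝ) ^ (2 : ℝ) := by rw [Real.rpow_two, sq]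
      _ ≤ (n : ℝ) ^ β := Real.rpow_le_rpow_of_exponent_le h1 hβ
  calc (E'.cost : ℝ) ≤ ((4 * E.cost + n * n : ℕ) : ℝ) := by exact_mod_cast hcost'
    _ = 4 * (E.cost : ℝ) + (n : ℝ) * n := by push_cast; ring
    _ ≤ 4 * (c * (n : ℝ) ^ β) + (n : ℝ) ^ β := by gcongr
    _ = (4 * c + 1) * (n : ℝ) ^ β := by ring

/-- **THE RIGID-QUADRIC SUB-RUNG OF `[ω₄ = ω]`**: cheap correct rigid quadric systems force `ω ≤ β`
— although they may be masked to order `2^{n²} − 1` over every base pair (M71). -/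
theorem omega_le_of_eqAdmissibleRigidQuad {β : ℝ} (hβ : 2 ≤ β) (h : EqAdmissibleRigidQuad β) :
    omega ℂ ≤ β :=
  reducedEquationsForceMultiplication_holds β hβ (eqAdmissibleRed_of_rigidQuad hβ h)

end Summit.MatrixMultiplication.MatrixMultiplication.Theorems.GraphEquations

end
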